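import Literature.Claims.NS.PereiraSilva2025
import Summits.NavierStokesRegularity.NavierStokesRegularity.Theorems.SoloSalvagePaiLimsuwan2026
import Literature.Analysis.FluidPDE.BKMClassEnstrophyContinuity
import Literature.Analysis.FluidPDE.TaoLocalisationHolds
import HarnessLib

/-!
# Solo salvage for claim C149 `PereiraSilva2025` (cell `ns-claims`, D-0090): the three TRUE classical
# steps of §3.1–§3.3 that the tree discharges at once, kernel

Claim skeleton: `Literature/Claims/NS/PereiraSilva2025.lean` (F. R. Pereira Silva, Zenodo 15214381, 6 pp.;
typist `ns-claims-typist-8` g6, p525554; class `PaiLimsuwan2026.SlabSol` = classical solution of the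
unforced system on `[0,T) × ℝ³` from a Schwartz divergence-free datum, finite energy, `ν > 0`). This file
(seat `ns-claims-salvage-p3` g4) proves, records-grade and off the verdict (token `Step32_PoincareSol`,
refuter-1 g4):

* `step31_Energy_holds : Step31_Energy` — §3.1 p.2 l.101–112 «`E(t) ≤ E(0)`»: from the landed energy
  inequality `…Theorems.PaiLimsuwan2026.step1_Energy24_holds` on the same class
  (`energy u t + 2ν∫₀ᵗ gradsq ≤ energy u 0`, dissipation non-negative);
* `step32_Cont_holds : Step32_Cont` — p.4 l.12–14 (implicit): `t ↦ ∫|ω(t)|²` is continuous on `[0,T)`: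
  a `SlabSol` is Tao-class on every closed sub-slab (`tao2011_hasBoundedSobolevNormsOn_holds`) and the
  enstrophy of a BKM-class solution is continuous there
  (`IsClassicalNSSolutionOn.continuousOn_integral_norm_curl_sq_Ico`, Majda–Bertozzi Thm 3.5);
* `step33_Gronwall_holds : Step33_Gronwall` — p.4 l.12–14, the real-variable Grönwall step exactly as
  typed (no sign hypothesis: `S·e^{−kt}` is non-increasing on `[0,T)`).

Solo lane (`Theorems/SoloSalvage<Slug>….lean`, no item); records-grade, no token effect.

WHAT THIS IS NOT: not a claim about NS regularity or blow-up; not a claim about any author beyond the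
typed locator.
-/

noncomputable section

set_option linter.dupNamespace false

open Set MeasureTheory Filter
open scoped ENNReal NNReal Topology

namespace Summit.NavierStokesRegularity.NavierStokesRegularity.Theorems.PereiraSilva2025Salvage

open Literature.Analysis Literature.Analysis.FluidPDE
open Literature.Claims.NS Literature.Claims.NS.PereiraSilva2025
open Literature.Claims.NS.PaiLimsuwan2026 (E3 SlabSol energy gradsq)

/-! ## §3.1 — the energy bound -/

/-- **Step 3.1 holds** (§3.1 p.2 l.101–112 «`E(t) = E(0) − ν∫₀ᵗS ≤ E(0)`»): along every `SlabSol`,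
`E(t) ≤ E(0)` on `[0,T)`, `E = ½∫|u|²`. From the kernel energy inequality of the same class
(`PaiLimsuwan2026.step1_Energy24_holds`: `‖u(t)‖² + 2ν∫₀ᵗ‖∇u‖² ≤ ‖u(0)‖²`) and `‖∇u‖² ≥ 0`.
[cite: PereiraSilva2025, §3.1 p.2 l.101–112] [cite: Tao2011, Lemma 8.1] -/
theorem step31_Energy_holds : Step31_Energy := by
  intro ν T u₀ u p hS t ht
  have h24 := Summit.NavierStokesRegularity.NavierStokesRegularity.Theorems.PaiLimsuwan2026.step1_Energy24_holds
    ν T u₀ u p hS t ht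
  have hν : 0 < ν := hS.visc
  have hdiss : 0 ≤ ∫ s in (0 : ℝ)..t, gradsq u s :=
    intervalIntegral.integral_nonneg ht.1 fun s _ => integral_nonneg fun x => by positivity
  have hE : energy u t ≤ energy u 0 := by nlinarith
  show (1 / 2) * ∫ x, ‖u t x‖ ^ 2 ≤ (1 / 2) * ∫ x, ‖u 0 x‖ ^ 2
  have hE' : ∫ x, ‖u t x‖ ^ 2 ≤ ∫ x, ‖u 0 x‖ ^ 2 := hE
  linarith

/-! ## §3.3 — continuity of the enstrophy on `[0,T)` -/

/-- A `SlabSol` has bounded `L²` Sobolev norms of all orders on every closed sub-slab `[0,T'']`, `T'' < T`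
(Tao 2011 Cor. 11.1: finite-energy classical solutions from Schwartz data are `H^k`-bounded on closed
slabs). [cite: Tao2011, Cor. 11.1] -/
theorem hasBoundedSobolevNormsOn_of_slabSol {ν T : ℝ} {u₀ : E3 → E3} {u : ℝ → E3 → E3} {p : ℝ → E3 → ℝ}
    (hS : SlabSol ν T u₀ u p) : ∀ T'' < T, HasBoundedSobolevNormsOn (Icc 0 T'') u := by
  intro T'' hT''
  have hν : 0 < ν := hS.visc
  obtain ⟨A, hA, hAle⟩ := hS.finiteEnergy
  have hdec0 : HasRapidSpatialDecay (u 0) := by rw [hS.initial]; exact hS.data_decay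
  -- bounds on the larger closed slab `[0, S]`, `S = max T'' ((T'' + T)/2)`-free choice: `S := (T'' + T)/2 ∨ T/2`
  by_cases hT : 0 < T
  · -- a positive closed sub-slab containing `[0, T'']`
    set S : ℝ := max T'' 0 / 2 + T / 2 with hSdef
    have hS0 : 0 < S := by rw [hSdef]; positivity
    have hST : S < T := by
      rw [hSdef]
      have : max T'' 0 < T := max_lt hT'' hT
      linarith
    have hT''S : T'' ≤ S := by
      rw [hSdef]
      have : T'' ≤ max T'' 0 := le_max_left _ _
      linarith [le_max_right T'' 0]
    have hsub : Icc (0 : ℝ) S ⊆ Ico 0 T := fun s hs => ⟨hs.1, hs.2.trans_lt hST⟩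
    have hcl : IsClassicalNSSolutionOn (Icc 0 S) ν 0 u p := hS.solves.mono hsub (uniqueDiffOn_Icc hS0)
    have hE : ∃ C : ℝ≥0, ∀ s ∈ Icc (0 : ℝ) S, ∫⁻ x, ‖u s x‖ₑ ^ 2 ≤ C :=
      ⟨A.toNNReal, fun s hs => (hAle s (hsub hs)).trans (ENNReal.coe_toNNReal hA.ne).symm.le⟩
    have hB : HasBoundedSobolevNormsOn (Icc 0 S) u :=
      tao2011_hasBoundedSobolevNormsOn_holds hν hS0 hcl hE hdec0
    exact hB.mono (Icc_subset_Icc le_rfl hT''S)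
  · -- `T ≤ 0`: then `T'' < T ≤ 0` and `[0, T'']` is empty
    have hempty : Icc (0 : ℝ) T'' = ∅ := Icc_eq_empty (by linarith [not_lt.1 hT])
    rw [hempty]
    exact fun n => ⟨0, fun t ht => absurd ht (notMem_empty t)⟩

/-- **Step 3.2-cont holds** (p.4 l.12–14, what Grönwall from `t = 0` presupposes): along every
`SlabSol`, `t ↦ S(t) = ∫|ω(t)|²` is continuous on `[0,T)` (Majda–Bertozzi Thm 3.5 on the closed
sub-slabs, where the solution is `H^k`-bounded by Tao Cor. 11.1).
[cite: PereiraSilva2025, §3.3 p.4 l.12–14] [cite: MajdaBertozziCUP2002, §3.2.2 Thm. 3.5 (PDF p. 92)] -/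
theorem step32_Cont_holds : Step32_Cont := by
  intro ν T u₀ u p hS
  show ContinuousOn (fun t => ∫ x, ‖curl (u t) x‖ ^ 2) (Ico 0 T)
  exact hS.solves.continuousOn_integral_norm_curl_sq_Ico (hasBoundedSobolevNormsOn_of_slabSol hS)

/-! ## §3.3 — the Grönwall step at the real grain -/

/-- **Step 3.3-Grönwall holds** (p.4 l.12–14 «the solution is `S(t) ≤ S(0)e^{(k₁−k₂)t}`», real grain):
a function continuous on `[0,T)`, differentiable on `(0,T)` with `S' ≤ kS` there, satisfies
`S(t) ≤ S(0)e^{kt}` on `[0,T)` — for ANY sign of `S` (`t ↦ S(t)e^{−kt}` has derivative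
`(S' − kS)e^{−kt} ≤ 0` on the interior, hence is non-increasing on the convex set `[0,T)`).
[cite: PereiraSilva2025, §3.3 p.4 l.12–14] -/
theorem step33_Gronwall_holds : Step33_Gronwall := by
  intro T k S hSc hS' t ht
  -- `F(s) = S(s) e^{-k s}` is antitone on `[0, T)`
  set F : ℝ → ℝ := fun s => S s * Real.exp (-k * s) with hF
  have hFc : ContinuousOn F (Ico 0 T) :=
    hSc.mul ((Real.continuous_exp.comp (continuous_const.mul continuous_id)).continuousOn)
  have hint : interior (Ico (0 : ℝ) T) = Ioo 0 T := interior_Ico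
  have key : ∀ s ∈ Ioo (0 : ℝ) T, ∃ D' : ℝ, HasDerivAt F D' s ∧ D' ≤ 0 := by
    intro s hs
    obtain ⟨D, hD, hle⟩ := hS' s hs
    have hexp : HasDerivAt (fun x => Real.exp (-k * x)) (Real.exp (-k * s) * (-k)) s := by
      have h1 : HasDerivAt (fun x => -k * x) (-k) s := by
        simpa using (hasDerivAt_id s).const_mul (-k)
      simpa [mul_comm] using h1.exp
    refine ⟨D * Real.exp (-k * s) + S s * (Real.exp (-k * s) * (-k)), hD.mul hexp, ?_⟩
    have hrew : D * Real.exp (-k * s) + S s * (Real.exp (-k * s) * (-k)) =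
        (D - k * S s) * Real.exp (-k * s) := by ring
    rw [hrew]
    exact mul_nonpos_of_nonpos_of_nonneg (by linarith) (Real.exp_pos _).le
  have hFd' : DifferentiableOn ℝ F (interior (Ico (0 : ℝ) T)) := by
    rw [hint]
    intro s hs
    obtain ⟨D', hd, -⟩ := key s hs
    exact hd.differentiableAt.differentiableWithinAt
  have hderiv_nonpos : ∀ s ∈ interior (Ico (0 : ℝ) T), deriv F s ≤ 0 := by
    rw [hint]
    intro s hs
    obtain ⟨D', hd, hle⟩ := key s hs
    rw [hd.deriv]
    exact hle
  have hanti : AntitoneOn F (Ico 0 T) :=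
    antitoneOn_of_deriv_nonpos (convex_Ico 0 T) hFc hFd' hderiv_nonpos
  have h0 : (0 : ℝ) ∈ Ico 0 T := ⟨le_rfl, lt_of_le_of_lt ht.1 ht.2⟩
  have hle : F t ≤ F 0 := hanti h0 ht ht.1
  have hF0 : F 0 = S 0 := by simp [hF]
  have hFt : F t = S t * Real.exp (-k * t) := rfl
  rw [hF0, hFt] at hle
  have hpos : 0 < Real.exp (-k * t) := Real.exp_pos _
  have hprod : Real.exp (-k * t) * Real.exp (k * t) = 1 := by
    rw [← Real.exp_add]; simp
  calc S t = S t * Real.exp (-k * t) * Real.exp (k * t) := by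
        rw [mul_assoc, hprod, mul_one]
    _ ≤ S 0 * Real.exp (k * t) := mul_le_mul_of_nonneg_right hle (Real.exp_pos _).le

end Summit.NavierStokesRegularity.NavierStokesRegularity.Theorems.PereiraSilva2025Salvage

end
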